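import Mathlib
import HarnessLib
import Summits.ValiantsHypothesis.ValiantsHypothesis.Theorems.LacunarySymmetroidMatrixDescartesProductPlusOneSeparatingWeight

/-!
# ValiantsHypothesis / LacunarySymmetroid — crux `MatrixDescartes` (stmt-ValiantsHypothesis-18050, V1),
# LINE (A) «product_plus_one», floor `OneChangeFloorK3`: the RATIO-ORDERED SECTOR WITH ONE-SIGNED ROWS (K = 3, every ratio)

Companion of ✓ `…ProductPlusOneSeparatingWeight` (separating-weight law; ratio-ordered sector of the PURE incoherent core).  The
floor's open core of record has two parts: incoherent `(+,−,−)` rows at ratio `> 4`, and incoherent rows IN COMPANY WITH ONE-SIGNED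
`(+,+,+)` rows at ANY ratio («no sector at any ratio», skeleton docstring of `stub_oneChangeFloorK3`).  For the intermediate weight
`λ(β, x)` of the separating-weight law a one-signed row `g = a + b x^p + c x^q` (`a, b, c > 0`, never vanishing, `θg > 0`) behaves
EXACTLY LIKE A SWITCHED incoherent row: it is separated iff `b/c ≥ β` (`g·(βc − b) ≤ 0` with `g > 0`).  Hence:

* `sepWeight_prod_pos_roots_le_mixed` — a company of incoherent no-dip and one-signed trinomial rows has `Z₊(P) ≤ m`;
* ★★ `sepWeight_ratioOrdered_withOneSigned` — MIXED RATIO-ORDERED SECTOR (K = 3, bottom coupling, EVERY support ratio): if at every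
  `x > 0` every one-signed row and every switched incoherent row has middle/top ratio `b/c` at least that of every unswitched incoherent
  row, then `Z₊(X·P′) ≤ m + (m + 1)`.  (E.g. one-signed rows with `b_j/c_j ≥ max_i |b_i|/|c_i|` over the incoherent rows, the latter
  ratio-ordered along their zeros; any number of rows of either kind.)

HONEST FRAMING: a sector of the research floor `stub_oneChangeFloorK3` (helper, `--supports stmt-ValiantsHypothesis-18050`); NOT
`OneChangeFloorK3` / `stub_eulerBoundK3` / `stub_classRowK3` / `stub_polyLaw` / `MatrixDescartes`; `VP ≠ VNP` is NOT proved.  No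
definitions, no named facts, no sorry; Mathlib + the lane files.
-/

set_option linter.dupNamespace false

namespace Summit.ValiantsHypothesis.ValiantsHypothesis.Theorems.LacunarySymmetroidMatrixDescartes

namespace ProductPlusOne

open Polynomial Finset
open scoped BigOperators

/-- a one-signed trinomial row (`a, b, c > 0`) has no positive zero. [folklore] -/
theorem sepWeight_oneSigned_eval_pos (a b c : ℝ) (e k : ℕ) (ha : 0 < a) (hb : 0 < b) (hc : 0 < c) {x : ℝ} (hx : 0 < x) :
    0 < a + b * x ^ (e + 1) + c * x ^ (e + k + 2) := by
  positivity

/-- **`Z₊(P) ≤ m`** for a company of incoherent no-dip rows (`a > 0`, `b, c < 0`) and one-signed rows (`a, b, c > 0`). [this file's lemma] -/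
theorem sepWeight_prod_pos_roots_le_mixed {m : ℕ} (a b c : Fin m → ℝ) (e k : ℕ)
    (hrows : ∀ j, (0 < a j ∧ b j < 0 ∧ c j < 0) ∨ (0 < a j ∧ 0 < b j ∧ 0 < c j)) :
    (∏ j, (C (a j) + C (b j) * X ^ (e + 1) + C (c j) * X ^ (e + k + 2)) : ℝ[X]) ≠ 0 ∧
    ((∏ j, (C (a j) + C (b j) * X ^ (e + 1) + C (c j) * X ^ (e + k + 2)) : ℝ[X]).roots.toFinset.filter
      (fun t => 0 < t)).card ≤ m := by
  classical
  have ha : ∀ j, 0 < a j := fun j => (hrows j).elim (fun h => h.1) (fun h => h.1)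
  have hne : ∀ j, (C (a j) + C (b j) * X ^ (e + 1) + C (c j) * X ^ (e + k + 2) : ℝ[X]) ≠ 0 := by
    intro j h0
    have h := congrArg (Polynomial.eval 0) h0
    simp only [eval_add, eval_mul, eval_C, eval_pow, eval_X, zero_pow (Nat.succ_ne_zero _), mul_zero, add_zero,
      eval_zero] at h
    exact (ha j).ne' h
  have hP0 : (∏ j, (C (a j) + C (b j) * X ^ (e + 1) + C (c j) * X ^ (e + k + 2)) : ℝ[X]) ≠ 0 :=
    Finset.prod_ne_zero_iff.mpr fun j _ => hne j
  refine ⟨hP0, ?_⟩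
  have hsub : ((∏ j, (C (a j) + C (b j) * X ^ (e + 1) + C (c j) * X ^ (e + k + 2)) : ℝ[X]).roots.toFinset.filter
      (fun t => 0 < t)) ⊆ Finset.univ.biUnion (fun j =>
        ((C (a j) + C (b j) * X ^ (e + 1) + C (c j) * X ^ (e + k + 2) : ℝ[X]).roots.toFinset.filter (fun t => 0 < t))) := by
    intro x hx
    rw [mem_filter, Multiset.mem_toFinset, mem_roots hP0, IsRoot.def, eval_prod, Finset.prod_eq_zero_iff] at hx
    obtain ⟨⟨j, _, hj⟩, hx0⟩ := hx
    rw [mem_biUnion]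
    refine ⟨j, mem_univ _, ?_⟩
    rw [mem_filter, Multiset.mem_toFinset, mem_roots (hne j), IsRoot.def]
    exact ⟨hj, hx0⟩
  refine (card_le_card hsub).trans (card_biUnion_le.trans ?_)
  calc ∑ j, (((C (a j) + C (b j) * X ^ (e + 1) + C (c j) * X ^ (e + k + 2) : ℝ[X]).roots.toFinset.filter
          (fun t => 0 < t))).card
      ≤ ∑ _j : Fin m, 1 := by
        refine Finset.sum_le_sum (fun j _ => ?_)
        rcases hrows j with h | h
        · exact trinomial_pos_roots_le_one _ _ _ e k (mul_neg_of_pos_of_neg h.1 h.2.2)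
        · -- one-signed: no positive zero at all
          have hempty : ((C (a j) + C (b j) * X ^ (e + 1) + C (c j) * X ^ (e + k + 2) : ℝ[X]).roots.toFinset.filter
              (fun t => 0 < t)) = ∅ := by
            rw [Finset.filter_eq_empty_iff]
            intro x hx hxpos
            rw [Multiset.mem_toFinset, mem_roots (hne j), IsRoot.def] at hx
            simp only [eval_add, eval_mul, eval_C, eval_pow, eval_X] at hx
            exact (sepWeight_oneSigned_eval_pos (a j) (b j) (c j) e k h.1 h.2.1 h.2.2 hxpos).ne' hx
          rw [hempty, Finset.card_empty]
          exact Nat.zero_le _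
    _ = m := by simp

/-- ★★ **THE MIXED RATIO-ORDERED SECTOR** (K = 3, bottom coupling, EVERY support ratio): rows `g_j = a_j + b_j X^{e+1} + c_j X^{e+k+2}`,
each either incoherent no-dip (`a_j > 0`, `b_j, c_j < 0`) or one-signed (`a_j, b_j, c_j > 0`).  If at every `x > 0`, for every row `j`
that is one-signed or switched incoherent (`g_j(x) < 0`) and every unswitched incoherent row `i` (`g_i(x) > 0`) the middle/top ratios
satisfy `b_i/c_i ≤ b_j/c_j`, then `Z₊(X·P′) ≤ m + (m + 1)`. [this file's theorem] -/
theorem sepWeight_ratioOrdered_withOneSigned {m : ℕ} (a b c : Fin m → ℝ) (e k : ℕ)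
    (hrows : ∀ j, (0 < a j ∧ b j < 0 ∧ c j < 0) ∨ (0 < a j ∧ 0 < b j ∧ 0 < c j))
    (hord : ∀ x : ℝ, 0 < x → ∀ j i,
      (0 < c j ∨ a j + b j * x ^ (e + 1) + c j * x ^ (e + k + 2) < 0) →
      c i < 0 → 0 < a i + b i * x ^ (e + 1) + c i * x ^ (e + k + 2) → b i / c i ≤ b j / c j) :
    ((X * derivative (∏ j, (C (a j) + C (b j) * X ^ (e + 1) + C (c j) * X ^ (e + k + 2)))
        - C (0 : ℝ) * ∏ j, (C (a j) + C (b j) * X ^ (e + 1) + C (c j) * X ^ (e + k + 2)) : ℝ[X]).roots.toFinset.filter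
      (fun t => 0 < t)).card ≤ m + (m + 1) := by
  classical
  rcases Nat.eq_zero_or_pos m with hm | hm
  · subst hm
    simp
  obtain ⟨hP0, hZ⟩ := sepWeight_prod_pos_roots_le_mixed a b c e k hrows
  refine sepWeight_XderivP_pos_roots_le_of_ratioSeparated a b c e k hP0 m hZ ?_
  intro z hz hg _hEz
  have hratio_pos : ∀ j, 0 < b j / c j := fun j =>
    (hrows j).elim (fun h => div_pos_of_neg_of_neg h.2.1 h.2.2) (fun h => div_pos h.2.1 h.2.2)
  -- `θg_j(z) ≠ 0` for both kinds of rows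
  have hN : ∀ j, ((e : ℝ) + 1) * b j * z ^ (e + 1) + ((e : ℝ) + k + 2) * c j * z ^ (e + k + 2) ≠ 0 := by
    intro j
    rcases hrows j with h | h
    · have h1 : ((e : ℝ) + 1) * b j * z ^ (e + 1) < 0 :=
        mul_neg_of_neg_of_pos (mul_neg_of_pos_of_neg (by positivity) h.2.1) (by positivity)
      have h2 : ((e : ℝ) + k + 2) * c j * z ^ (e + k + 2) < 0 :=
        mul_neg_of_neg_of_pos (mul_neg_of_pos_of_neg (by positivity) h.2.2) (by positivity)
      linarith
    · have h1 : 0 < ((e : ℝ) + 1) * b j * z ^ (e + 1) := by have := h.2.1; positivity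
      have h2 : 0 < ((e : ℝ) + k + 2) * c j * z ^ (e + k + 2) := by have := h.2.2; positivity
      linarith
  -- «positive» rows at `z`: one-signed, or switched incoherent
  set R : Finset (Fin m) := Finset.univ.filter
    (fun j => 0 < c j ∨ a j + b j * z ^ (e + 1) + c j * z ^ (e + k + 2) < 0) with hR
  by_cases hRne : R.Nonempty
  · obtain ⟨j₀, hj₀, hmin⟩ := R.exists_min_image (fun j => b j / c j) hRne
    have hj₀' : 0 < c j₀ ∨ a j₀ + b j₀ * z ^ (e + 1) + c j₀ * z ^ (e + k + 2) < 0 := (Finset.mem_filter.mp hj₀).2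
    refine ⟨b j₀ / c j₀, (hratio_pos j₀).le, fun j => ⟨?_, hN j⟩⟩
    rcases hrows j with h | h
    · -- incoherent row
      rcases lt_or_gt_of_ne (hg j) with hlt | hgt
      · -- switched: in `R`, so `β ≤ b_j/c_j`, i.e. `b_j ≤ β c_j` (`c_j < 0`)
        have hle : b j₀ / c j₀ ≤ b j / c j := hmin j (Finset.mem_filter.mpr ⟨Finset.mem_univ _, Or.inr hlt⟩)
        have h1 : b j ≤ b j₀ / c j₀ * c j := (le_div_iff_of_neg h.2.2).mp hle
        nlinarith
      · -- unswitched: the order hypothesis against `j₀`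
        have hle : b j / c j ≤ b j₀ / c j₀ := hord z hz j₀ j hj₀' h.2.2 hgt
        have h1 : b j₀ / c j₀ * c j ≤ b j := (div_le_iff_of_neg h.2.2).mp hle
        nlinarith
    · -- one-signed row: in `R`, `β ≤ b_j/c_j`, i.e. `β c_j ≤ b_j` (`c_j > 0`); and `g_j > 0`
      have hle : b j₀ / c j₀ ≤ b j / c j := hmin j (Finset.mem_filter.mpr ⟨Finset.mem_univ _, Or.inl h.2.2⟩)
      have h1 : b j₀ / c j₀ * c j ≤ b j := (le_div_iff₀ h.2.2).mp hle
      have hgpos := sepWeight_oneSigned_eval_pos (a j) (b j) (c j) e k h.1 h.2.1 h.2.2 hz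
      nlinarith
  · -- no positive row: every row is unswitched incoherent; pivot = the largest ratio
    obtain ⟨j₁, -, hmax⟩ := Finset.univ.exists_max_image (fun j => b j / c j) ⟨⟨0, hm⟩, Finset.mem_univ _⟩
    refine ⟨b j₁ / c j₁, (hratio_pos j₁).le, fun j => ⟨?_, hN j⟩⟩
    have hnot : ¬ (0 < c j ∨ a j + b j * z ^ (e + 1) + c j * z ^ (e + k + 2) < 0) :=
      fun h => hRne ⟨j, Finset.mem_filter.mpr ⟨Finset.mem_univ _, h⟩⟩
    have hcneg : c j < 0 := by
      rcases hrows j with h | h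
      · exact h.2.2
      · exact absurd (Or.inl h.2.2) hnot
    have hgt : 0 < a j + b j * z ^ (e + 1) + c j * z ^ (e + k + 2) := by
      rcases lt_or_gt_of_ne (hg j) with hlt | hgt
      · exact absurd (Or.inr hlt) hnot
      · exact hgt
    have hle : b j / c j ≤ b j₁ / c j₁ := hmax j (Finset.mem_univ _)
    have h1 : b j₁ / c j₁ * c j ≤ b j := (div_le_iff_of_neg hcneg).mp hle
    nlinarith

end ProductPlusOne

end Summit.ValiantsHypothesis.ValiantsHypothesis.Theorems.LacunarySymmetroidMatrixDescartes
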